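import Summits.AtomisticToContinuum.HydrodynamicLimit.Theorems.CollisionIsometryCLTDiffuseBackwardInfluenceConditionalPair
import Summits.AtomisticToContinuum.HydrodynamicLimit.Theorems.CollisionIsometryCLTDiffuseBackwardInfluencePairBound
import Summits.AtomisticToContinuum.HydrodynamicLimit.Theorems.CollisionIsometryCLTDiffuseBackwardInfluencePairMeasurableD
import HarnessLib

/-!
# The crux `DiffuseBackwardInfluence` from its three conjecture-level inputs (line `share-nondegeneracy-one-flight`, skeleton v8)
(stmt-AtomisticToContinuum-12950, route `CollisionIsometryCLT`; registered sub-goal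
`diffuseBackwardInfluence_of_nearSetLD_of_remergeBounded_of_delayedRemergeRare`; `--supports` file)

Kernel-checked end state of skeleton v8: with the three PROVED stubs imported —
  * `stub_pairPathBoundT` (…PairBound, the pathwise pair-path bound with tagged deficit),
  * `stub_delayedRemMeasurable` (…PairMeasurableD),
  * `stub_cruxCompositionT` (…ConditionalPair, the composition with the row budget, the tube input, the entropy transfer and
    `shareLDAt_of_nearSetLD`, all landed) —
the crux decl follows from exactly the three conjecture-level statements typed in the tree:
  * the lever `ShareLD.NearSetLD σ θ` below a density threshold (…OneFlightShareLD; N-uniform one-collision chaos),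
  * `PairPath.RemergeBounded` (…PairDefs; two-tracer renewal defect: re-merges bounded in mean),
  * `DelayedRemergeRare` (…PairDelayedDefs; pair transience at diverging lag).
This replaces the circular hypothesis `LateMerges.LateTouchRare` of `diffuseBackwardInfluence_of_nearSetLD_of_lateTouchRare`
(…Conditional.lean) by two honest two-body inputs (crux NOTES §15–§17, strategist STRATEGY-CENSUS D3). It is the glue a route-level
split of the crux into these three statements would cite.
-/

namespace Summit.AtomisticToContinuum.HydrodynamicLimit.Theorems.DiffuseBackwardInfluenceShare

open scoped BigOperators Topology ENNReal InnerProductSpace Classical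
open Filter Set MeasureTheory

noncomputable section

/-- **THE CRUX, CONDITIONALLY ON ITS THREE CONJECTURE-LEVEL INPUTS** (registered sub-goal
`diffuseBackwardInfluence_of_nearSetLD_of_remergeBounded_of_delayedRemergeRare` of skeleton v8): the prescribed-set directional
large deviation `ShareLD.NearSetLD` below a density threshold, boundedness in mean of the re-merges of the two influence tracers
(`PairPath.RemergeBounded`) and rarity of delayed re-merges (`DelayedRemergeRare`) together imply `DiffuseBackwardInfluence`.
Proof: `stub_cruxCompositionT` fed with the landed `stub_pairPathBoundT` and `stub_delayedRemMeasurable`; the crux's `let M`,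
`let ipr` are `DiffuseBackwardInfluenceNeg.transfer/ipr` definitionally, so `CruxConclusionAt` closes it by `exact`. [folklore] -/
theorem diffuseBackwardInfluence_of_nearSetLD_of_remergeBounded_of_delayedRemergeRare : (∃ σ₀ : ℝ, 0 < σ₀ ∧ ∀ σ : ℝ, 0 < σ → σ < σ₀ → ∀ θ : ℝ, 0 < θ → ShareLD.NearSetLD σ θ) → PairPath.RemergeBounded → DelayedRemergeRare → Summit.AtomisticToContinuum.HydrodynamicLimit.Theses.CollisionIsometryCLT.DiffuseBackwardInfluence := by
  intro hNear hRem hDel a₀ θ₀ u₀ ha hθ hu ha0 hθ0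
  obtain ⟨σ₀, hσ₀, H⟩ := stub_cruxCompositionT stub_pairPathBoundT stub_delayedRemMeasurable hNear hRem hDel
    a₀ θ₀ u₀ ha hθ hu ha0 hθ0
  refine ⟨σ₀, hσ₀, ?_⟩
  intro σ hσ hσlt M ipr' Φ Δ hΔ hΔ0 hΔ1 t ht
  exact H σ hσ hσlt Φ Δ hΔ hΔ0 hΔ1 t ht

end

end Summit.AtomisticToContinuum.HydrodynamicLimit.Theorems.DiffuseBackwardInfluenceShare
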